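import Mathlib
import Summits.ValiantsHypothesis.ValiantsHypothesis.Theorems.LacunarySymmetroidMatrixDescartesRegimeWindows

/-!
# `MatrixDescartes` (stmt-ValiantsHypothesis-18050) — the DOMINANT-MIDDLE LAW: two sign alternations `(+)(−)(+)` of
# semidefinite letters with a negative block that dominates at one scale ⇒ `Z₊ ≤ 2m` (K-free)

HONEST FRAMING.  Cell `pub-symmetroid`, seat `val-sym-mdr-p2` (gen 4); helper file `--supports` the crux
`Theses.LacunarySymmetroid.MatrixDescartes`.  A SECTOR theorem: nothing here bears on the crux in general, on the line
`Lift`'s open stub `stub_twoSided`, on `DoorA26` / `DoorA34`, or on `VP ≠ VNP`.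

THE LAW (`dominantMiddle`).  `F = ∑ₗ X^{dₗ} Sₗ`, real symmetric `ι × ι` letters at strictly increasing exponents, in
three consecutive blocks: HEAD `l ≤ h` with `Sₗ ⪰ 0`, MIDDLE `h < l < τ` with `Sₗ ⪯ 0`, TAIL `l ≥ τ` with `Sₗ ⪰ 0` —
the sign word `(+)(−)(+)` with `α = 2` alternations, for which the Cameron–Psarrakos count `z₊ ≤ n·α = 2n`
[CameronPsarrakos2019, display (6)] is FALSE unconditionally (tree `cameronPsarrakos_counterexample`, `6 > 4` at
`n = 2`).  DOMINANCE at a scale `x₁ > 0`: there are middle letters `μ, μ'` with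
  `(d_μ − d_h)·(−S_μ) ⪰ ∑_{l ≥ τ} (d_l − d_h)·x₁^{d_l − d_μ}·S_l`   and
  `(d_τ − d_μ')·(−S_μ') ⪰ ∑_{l ≤ h} (d_τ − d_l)·x₁^{−(d_μ' − d_l)}·S_l`
(the negative block outweighs the tail seen from the head pivot `d_h`, and the head seen from the tail pivot `d_τ`, at
scale `x₁`).  THEN `det F` has at most `2·card ι` distinct positive zeros: the Cameron–Psarrakos count for `α = 2`,
restored under a MAGNITUDE hypothesis.  Tight (diagonal `(+)(−)(+)` trinomials with two positive roots each).

PROOF = two regime windows (`twoWindows_posRoots_le`): on `(0, x₁]` the family `F/x^{d_h}` is Loewner non-increasing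
(head weights `x^{d_l−d_h}` decrease, middle weights increase on NSD letters, and the tail's increase is dominated by
`μ`'s decrease via `γ_μ(t^{γ_l} − s^{γ_l}) ≤ γ_l x₁^{γ_l−γ_μ}(t^{γ_μ} − s^{γ_μ})` for `s ≤ t ≤ x₁`, `γ = d − d_h`);
on `[x₁, ∞)` the family `F/x^{d_τ}` is Loewner non-decreasing symmetrically (`μ'` dominates the head).  The scalar
comparison `DominantMiddle.pow_sub_pow_compare`: `b(ρ^{b+k} − σ^{b+k}) ≤ (b+k)ρ^k(ρ^b − σ^b)` for `0 ≤ σ ≤ ρ`, `b ≥ 1`.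
At `card ι = 1` the bound `2` is Descartes'; the content is for matrices.  Crux currency: `dominantMiddle_realRoots_le`
(`≤ 4·card ι + 1` real zeros when `F(X)` and `F(−X)` are both dominant-middle words), `dominantMiddle_mdr`.
[folklore] Elementary; Mathlib + tree lemmas (`twoWindows_posRoots_le`, `stub_negRoots`, `Census.fatFormat_absorb`,
`OneAlternation.dotProduct_family_mulVec`); axioms `propext`, `Classical.choice`, `Quot.sound`.
-/

-- layout Summits/ValiantsHypothesis/ValiantsHypothesis forces the duplicated namespace component
set_option linter.dupNamespace false

namespace Summit.ValiantsHypothesis.ValiantsHypothesis.Theorems.LacunarySymmetroidMatrixDescartes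

open Polynomial Matrix Finset
open scoped BigOperators

namespace DominantMiddle

/-! ## §1 Power comparisons -/

/-- `(b+1)·σ^b·(ρ − σ) ≤ ρ^{b+1} − σ^{b+1}` for `0 ≤ σ ≤ ρ`. [folklore] -/
theorem pow_sub_pow_ge (σ ρ : ℝ) (hσ : 0 ≤ σ) (hσρ : σ ≤ ρ) :
    ∀ b : ℕ, ((b : ℝ) + 1) * σ ^ b * (ρ - σ) ≤ ρ ^ (b + 1) - σ ^ (b + 1)
  | 0 => by simp
  | b + 1 => by
    have ih := pow_sub_pow_ge σ ρ hσ hσρ b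
    have h1 : σ * (((b : ℝ) + 1) * σ ^ b * (ρ - σ)) ≤ σ * (ρ ^ (b + 1) - σ ^ (b + 1)) :=
      mul_le_mul_of_nonneg_left ih hσ
    have h2 : σ * (ρ ^ (b + 1) - σ ^ (b + 1)) ≤ ρ * (ρ ^ (b + 1) - σ ^ (b + 1)) :=
      mul_le_mul_of_nonneg_right hσρ (sub_nonneg.2 (pow_le_pow_left₀ hσ hσρ _))
    have e1 : (((b + 1 : ℕ) : ℝ) + 1) * σ ^ (b + 1) * (ρ - σ)
        = σ * (((b : ℝ) + 1) * σ ^ b * (ρ - σ)) + σ ^ (b + 1) * (ρ - σ) := by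
      push_cast; ring
    have e2 : ρ ^ (b + 1 + 1) - σ ^ (b + 1 + 1)
        = ρ * (ρ ^ (b + 1) - σ ^ (b + 1)) + σ ^ (b + 1) * (ρ - σ) := by ring
    rw [e1, e2]
    linarith

/-- `b·(ρ^{b+k} − σ^{b+k}) ≤ (b+k)·ρ^k·(ρ^b − σ^b)` for `0 ≤ σ ≤ ρ` and `b ≥ 1`. [folklore] -/
theorem pow_sub_pow_compare (σ ρ : ℝ) (hσ : 0 ≤ σ) (hσρ : σ ≤ ρ) (b : ℕ) (hb : 1 ≤ b) :
    ∀ k : ℕ, (b : ℝ) * (ρ ^ (b + k) - σ ^ (b + k)) ≤ ((b : ℝ) + k) * ρ ^ k * (ρ ^ b - σ ^ b)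
  | 0 => by simp
  | k + 1 => by
    have ih := pow_sub_pow_compare σ ρ hσ hσρ b hb k
    have hρ : 0 ≤ ρ := hσ.trans hσρ
    obtain ⟨b', rfl⟩ := Nat.exists_eq_add_of_le' hb
    -- `ρ^b − σ^b ≥ b σ^{b−1} (ρ − σ)`
    have hge := pow_sub_pow_ge σ ρ hσ hσρ b'
    have hdiff : 0 ≤ ρ ^ (b' + 1) - σ ^ (b' + 1) := sub_nonneg.2 (pow_le_pow_left₀ hσ hσρ _)
    -- the increment `b σ^{b+k} (ρ − σ) ≤ ρ^{k+1} (ρ^b − σ^b)`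
    have hinc : ((b' + 1 : ℕ) : ℝ) * σ ^ (b' + 1 + k) * (ρ - σ)
        ≤ ρ ^ (k + 1) * (ρ ^ (b' + 1) - σ ^ (b' + 1)) := by
      have h1 : σ ^ (k + 1) * ((((b' : ℕ) : ℝ) + 1) * σ ^ b' * (ρ - σ))
          ≤ σ ^ (k + 1) * (ρ ^ (b' + 1) - σ ^ (b' + 1)) :=
        mul_le_mul_of_nonneg_left hge (pow_nonneg hσ _)
      have h2 : σ ^ (k + 1) * (ρ ^ (b' + 1) - σ ^ (b' + 1))
          ≤ ρ ^ (k + 1) * (ρ ^ (b' + 1) - σ ^ (b' + 1)) :=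
        mul_le_mul_of_nonneg_right (pow_le_pow_left₀ hσ hσρ _) hdiff
      have e : ((b' + 1 : ℕ) : ℝ) * σ ^ (b' + 1 + k) * (ρ - σ)
          = σ ^ (k + 1) * ((((b' : ℕ) : ℝ) + 1) * σ ^ b' * (ρ - σ)) := by
        push_cast; ring
      rw [e]
      exact h1.trans h2
    have hih' : ρ * (((b' + 1 : ℕ) : ℝ) * (ρ ^ (b' + 1 + k) - σ ^ (b' + 1 + k)))
        ≤ ρ * ((((b' + 1 : ℕ) : ℝ) + k) * ρ ^ k * (ρ ^ (b' + 1) - σ ^ (b' + 1))) :=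
      mul_le_mul_of_nonneg_left ih hρ
    have e1 : ((b' + 1 : ℕ) : ℝ) * (ρ ^ (b' + 1 + (k + 1)) - σ ^ (b' + 1 + (k + 1)))
        = ρ * (((b' + 1 : ℕ) : ℝ) * (ρ ^ (b' + 1 + k) - σ ^ (b' + 1 + k)))
          + ((b' + 1 : ℕ) : ℝ) * σ ^ (b' + 1 + k) * (ρ - σ) := by ring
    have e2 : (((b' + 1 : ℕ) : ℝ) + ((k + 1 : ℕ) : ℝ)) * ρ ^ (k + 1) * (ρ ^ (b' + 1) - σ ^ (b' + 1))
        = ρ * ((((b' + 1 : ℕ) : ℝ) + k) * ρ ^ k * (ρ ^ (b' + 1) - σ ^ (b' + 1)))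
          + ρ ^ (k + 1) * (ρ ^ (b' + 1) - σ ^ (b' + 1)) := by
      push_cast; ring
    rw [e1, e2]
    linarith

/-- Window form: for `0 ≤ s ≤ t ≤ x₁` and `b ≥ 1`, `b·(t^{b+k} − s^{b+k}) ≤ (b+k)·x₁^k·(t^b − s^b)`. [folklore] -/
theorem pow_sub_pow_window {s t x₁ : ℝ} (hs : 0 ≤ s) (hst : s ≤ t) (htx : t ≤ x₁) (b k : ℕ) (hb : 1 ≤ b) :
    (b : ℝ) * (t ^ (b + k) - s ^ (b + k)) ≤ ((b : ℝ) + k) * x₁ ^ k * (t ^ b - s ^ b) := by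
  have h1 := pow_sub_pow_compare s t hs hst b hb k
  have h2 : t ^ k ≤ x₁ ^ k := pow_le_pow_left₀ (hs.trans hst) htx k
  have h3 : 0 ≤ t ^ b - s ^ b := sub_nonneg.2 (pow_le_pow_left₀ hs hst b)
  have h4 : ((b : ℝ) + k) * t ^ k * (t ^ b - s ^ b) ≤ ((b : ℝ) + k) * x₁ ^ k * (t ^ b - s ^ b) :=
    mul_le_mul_of_nonneg_right (mul_le_mul_of_nonneg_left h2 (by positivity)) h3
  exact h1.trans h4

/-! ## §2 The two window inequalities (scalars) -/

variable {K : ℕ}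

/-- Coefficient above the pivot: `u^{n} · (u^{e})⁻¹ = u^{n − e}` for `e ≤ n`, `u ≠ 0`. [folklore] -/
theorem coeff_above {u : ℝ} (hu : u ≠ 0) {e n : ℕ} (h : e ≤ n) : u ^ n * (u ^ e)⁻¹ = u ^ (n - e) := by
  rw [pow_sub₀ _ hu h]

/-- Coefficient below the pivot: `u^{n} · (u^{e})⁻¹ = (u^{e − n})⁻¹` for `n ≤ e`, `u ≠ 0`. [folklore] -/
theorem coeff_below {u : ℝ} (hu : u ≠ 0) {e n : ℕ} (h : n ≤ e) : u ^ n * (u ^ e)⁻¹ = (u ^ (e - n))⁻¹ := by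
  rw [pow_sub₀ _ hu h, mul_inv, inv_inv, mul_comm]

/-- **Left window.**  With `c_l(u) = u^{d_l}/u^{d_h}`: for `0 < s ≤ t ≤ x₁`, `∑ₗ (c_l(s) − c_l(t))·qₗ ≥ 0` under the
sign hypotheses (`qₗ ≥ 0` on head and tail, `≤ 0` in the middle) and the dominance
`∑_{l ≥ τ} (d_l − d_h)·x₁^{d_l − d_μ}·qₗ ≤ (d_μ − d_h)·(−q_μ)` by a middle index `μ`. [folklore] -/
theorem left_window_nonneg (d : Fin K → ℕ) (hd : StrictMono d) (h μ τ : Fin K) (hhμ : h < μ) (hμτ : μ < τ)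
    (q : Fin K → ℝ) (hhead : ∀ l, l ≤ h → 0 ≤ q l) (hmid : ∀ l, h < l → l < τ → q l ≤ 0)
    (htail : ∀ l, τ ≤ l → 0 ≤ q l) (x₁ : ℝ)
    (hdom : ∑ l ∈ univ.filter (fun l => τ ≤ l), ((d l - d h : ℕ) : ℝ) * x₁ ^ (d l - d μ) * q l
        ≤ ((d μ - d h : ℕ) : ℝ) * (-q μ))
    {s t : ℝ} (hs : 0 < s) (hst : s ≤ t) (htx : t ≤ x₁) :
    0 ≤ ∑ l, (s ^ d l * (s ^ d h)⁻¹ - t ^ d l * (t ^ d h)⁻¹) * q l := by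
  have ht : 0 < t := hs.trans_le hst
  have hdμ : d h < d μ := hd hhμ
  set f : Fin K → ℝ := fun l => (s ^ d l * (s ^ d h)⁻¹ - t ^ d l * (t ^ d h)⁻¹) * q l with hf
  -- split off the tail and the dominant letter `μ`
  have hμmem : μ ∈ univ.filter (fun l : Fin K => ¬ τ ≤ l) :=
    Finset.mem_filter.2 ⟨Finset.mem_univ _, not_le.2 hμτ⟩
  have hsplit : ∑ l, f l = ∑ l ∈ univ.filter (fun l => τ ≤ l), f l
      + (f μ + ∑ l ∈ (univ.filter (fun l : Fin K => ¬ τ ≤ l)).erase μ, f l) := by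
    rw [Finset.add_sum_erase _ _ hμmem, Finset.sum_filter_add_sum_filter_not]
  show 0 ≤ ∑ l, f l
  rw [hsplit]
  -- the remaining head/middle terms are termwise nonnegative
  have hrest : 0 ≤ ∑ l ∈ (univ.filter (fun l : Fin K => ¬ τ ≤ l)).erase μ, f l := by
    refine Finset.sum_nonneg fun l hl => ?_
    have hlτ : l < τ := not_le.1 (Finset.mem_filter.1 (Finset.mem_of_mem_erase hl)).2
    simp only [hf]
    rcases le_or_gt l h with hlh | hlh
    · -- head: coefficient `(u^{d_h − d_l})⁻¹` non-increasing, `q ≥ 0`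
      have hle : d l ≤ d h := hd.monotone hlh
      rw [coeff_below hs.ne' hle, coeff_below ht.ne' hle]
      exact mul_nonneg (sub_nonneg.2 (inv_anti₀ (pow_pos hs _) (pow_le_pow_left₀ hs.le hst _)))
        (hhead l hlh)
    · -- middle: coefficient `u^{d_l − d_h}` non-decreasing, `q ≤ 0`
      have hle : d h ≤ d l := hd.monotone hlh.le
      rw [coeff_above hs.ne' hle, coeff_above ht.ne' hle]
      exact mul_nonneg_of_nonpos_of_nonpos (sub_nonpos.2 (pow_le_pow_left₀ hs.le hst _))
        (hmid l hlh hlτ)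
  -- the tail is dominated by `μ`: `γ_μ · (f μ + ∑_tail f) ≥ 0`
  have hγμ : (0 : ℝ) < ((d μ - d h : ℕ) : ℝ) := by exact_mod_cast Nat.sub_pos_of_lt hdμ
  have hfμ : f μ = (t ^ (d μ - d h) - s ^ (d μ - d h)) * (-q μ) := by
    simp only [hf]
    rw [coeff_above hs.ne' hdμ.le, coeff_above ht.ne' hdμ.le]
    ring
  have htail_bound : ∀ l, τ ≤ l →
      -( ((d l - d h : ℕ) : ℝ) * x₁ ^ (d l - d μ) * (t ^ (d μ - d h) - s ^ (d μ - d h)) * q l)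
        ≤ ((d μ - d h : ℕ) : ℝ) * f l := by
    intro l hl
    have hμl : d μ < d l := hd (hμτ.trans_le hl)
    have hle : d h ≤ d l := (hdμ.trans hμl).le
    simp only [hf]
    rw [coeff_above hs.ne' hle, coeff_above ht.ne' hle]
    have ek : d l - d h = (d μ - d h) + (d l - d μ) := by omega
    have hcmp := pow_sub_pow_window hs.le hst htx (d μ - d h) (d l - d μ) (Nat.sub_pos_of_lt hdμ)
    rw [← ek] at hcmp
    have ecast : ((d μ - d h : ℕ) : ℝ) + ((d l - d μ : ℕ) : ℝ) = ((d l - d h : ℕ) : ℝ) := by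
      rw [← Nat.cast_add, ← ek]
    rw [ecast] at hcmp
    -- `hcmp : γ_μ (t^{γ_l} − s^{γ_l}) ≤ γ_l x₁^{k} (t^{γ_μ} − s^{γ_μ})`; multiply by `q l ≥ 0`
    have := mul_le_mul_of_nonneg_right hcmp (htail l hl)
    nlinarith [this]
  have htail_sum : -((t ^ (d μ - d h) - s ^ (d μ - d h))
        * ∑ l ∈ univ.filter (fun l => τ ≤ l), ((d l - d h : ℕ) : ℝ) * x₁ ^ (d l - d μ) * q l)
      ≤ ((d μ - d h : ℕ) : ℝ) * ∑ l ∈ univ.filter (fun l => τ ≤ l), f l := by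
    rw [Finset.mul_sum, Finset.mul_sum, ← Finset.sum_neg_distrib]
    refine Finset.sum_le_sum fun l hl => ?_
    have hb := htail_bound l (Finset.mem_filter.1 hl).2
    have e : (t ^ (d μ - d h) - s ^ (d μ - d h)) * (((d l - d h : ℕ) : ℝ) * x₁ ^ (d l - d μ) * q l)
        = ((d l - d h : ℕ) : ℝ) * x₁ ^ (d l - d μ) * (t ^ (d μ - d h) - s ^ (d μ - d h)) * q l := by
      ring
    rw [e]
    exact hb
  have hts : 0 ≤ t ^ (d μ - d h) - s ^ (d μ - d h) := sub_nonneg.2 (pow_le_pow_left₀ hs.le hst _)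
  have hdom' := mul_le_mul_of_nonneg_left hdom hts
  -- `γ_μ (f μ + tail) ≥ 0`
  have hkey : 0 ≤ ((d μ - d h : ℕ) : ℝ) * (∑ l ∈ univ.filter (fun l => τ ≤ l), f l + f μ) := by
    rw [mul_add, hfμ]
    nlinarith [htail_sum, hdom']
  have hkey' : 0 ≤ ∑ l ∈ univ.filter (fun l => τ ≤ l), f l + f μ :=
    nonneg_of_mul_nonneg_right hkey hγμ
  linarith

/-- **Right window.**  With `c_l(u) = u^{d_l}/u^{d_τ}`: for `x₁ ≤ s ≤ t` (`x₁ > 0`), `∑ₗ (c_l(t) − c_l(s))·qₗ ≥ 0`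
under the sign hypotheses and the dominance `∑_{l ≤ h} (d_τ − d_l)·(x₁⁻¹)^{d_μ' − d_l}·qₗ ≤ (d_τ − d_μ')·(−q_μ')`
by a middle index `μ'`. [folklore] -/
theorem right_window_nonneg (d : Fin K → ℕ) (hd : StrictMono d) (h μ' τ : Fin K) (hhμ' : h < μ')
    (hμ'τ : μ' < τ) (q : Fin K → ℝ) (hhead : ∀ l, l ≤ h → 0 ≤ q l)
    (hmid : ∀ l, h < l → l < τ → q l ≤ 0) (htail : ∀ l, τ ≤ l → 0 ≤ q l) (x₁ : ℝ) (hx₁ : 0 < x₁)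
    (hdom : ∑ l ∈ univ.filter (fun l => l ≤ h), ((d τ - d l : ℕ) : ℝ) * (x₁⁻¹) ^ (d μ' - d l) * q l
        ≤ ((d τ - d μ' : ℕ) : ℝ) * (-q μ'))
    {s t : ℝ} (hxs : x₁ ≤ s) (hst : s ≤ t) :
    0 ≤ ∑ l, (t ^ d l * (t ^ d τ)⁻¹ - s ^ d l * (s ^ d τ)⁻¹) * q l := by
  have hs : 0 < s := hx₁.trans_le hxs
  have ht : 0 < t := hs.trans_le hst
  have hdμ' : d μ' < d τ := hd hμ'τ
  -- reciprocal variables `σ = t⁻¹ ≤ ρ = s⁻¹ ≤ x₁⁻¹`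
  have hσ : 0 ≤ t⁻¹ := (inv_pos.2 ht).le
  have hσρ : t⁻¹ ≤ s⁻¹ := inv_anti₀ hs hst
  have hρx : s⁻¹ ≤ x₁⁻¹ := inv_anti₀ hx₁ hxs
  set f : Fin K → ℝ := fun l => (t ^ d l * (t ^ d τ)⁻¹ - s ^ d l * (s ^ d τ)⁻¹) * q l with hf
  have hμmem : μ' ∈ univ.filter (fun l : Fin K => ¬ l ≤ h) :=
    Finset.mem_filter.2 ⟨Finset.mem_univ _, not_le.2 hhμ'⟩
  have hsplit : ∑ l, f l = ∑ l ∈ univ.filter (fun l => l ≤ h), f l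
      + (f μ' + ∑ l ∈ (univ.filter (fun l : Fin K => ¬ l ≤ h)).erase μ', f l) := by
    rw [Finset.add_sum_erase _ _ hμmem, Finset.sum_filter_add_sum_filter_not]
  show 0 ≤ ∑ l, f l
  rw [hsplit]
  -- middle/tail terms other than `μ'` are termwise nonnegative
  have hrest : 0 ≤ ∑ l ∈ (univ.filter (fun l : Fin K => ¬ l ≤ h)).erase μ', f l := by
    refine Finset.sum_nonneg fun l hl => ?_
    have hlh : h < l := not_le.1 (Finset.mem_filter.1 (Finset.mem_of_mem_erase hl)).2
    simp only [hf]
    rcases lt_or_ge l τ with hlτ | hlτ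
    · -- middle: coefficient `(u^{d_τ − d_l})⁻¹` non-increasing, `q ≤ 0`
      have hle : d l ≤ d τ := hd.monotone hlτ.le
      rw [coeff_below hs.ne' hle, coeff_below ht.ne' hle]
      exact mul_nonneg_of_nonpos_of_nonpos
        (sub_nonpos.2 (inv_anti₀ (pow_pos hs _) (pow_le_pow_left₀ hs.le hst _))) (hmid l hlh hlτ)
    · -- tail: coefficient `u^{d_l − d_τ}` non-decreasing, `q ≥ 0`
      have hle : d τ ≤ d l := hd.monotone hlτ
      rw [coeff_above hs.ne' hle, coeff_above ht.ne' hle]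
      exact mul_nonneg (sub_nonneg.2 (pow_le_pow_left₀ hs.le hst _)) (htail l hlτ)
  -- the head is dominated by `μ'`
  have hγ : (0 : ℝ) < ((d τ - d μ' : ℕ) : ℝ) := by exact_mod_cast Nat.sub_pos_of_lt hdμ'
  have hfμ : f μ' = ((s⁻¹) ^ (d τ - d μ') - (t⁻¹) ^ (d τ - d μ')) * (-q μ') := by
    simp only [hf]
    rw [coeff_below hs.ne' hdμ'.le, coeff_below ht.ne' hdμ'.le, ← inv_pow, ← inv_pow]
    ring
  have hhead_bound : ∀ l, l ≤ h →
      -( ((d τ - d l : ℕ) : ℝ) * (x₁⁻¹) ^ (d μ' - d l) * ((s⁻¹) ^ (d τ - d μ') - (t⁻¹) ^ (d τ - d μ')) * q l)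
        ≤ ((d τ - d μ' : ℕ) : ℝ) * f l := by
    intro l hl
    have hlμ : d l < d μ' := hd (lt_of_le_of_lt hl hhμ')
    have hle : d l ≤ d τ := (hlμ.trans hdμ').le
    simp only [hf]
    rw [coeff_below hs.ne' hle, coeff_below ht.ne' hle, ← inv_pow, ← inv_pow]
    have ek : d τ - d l = (d τ - d μ') + (d μ' - d l) := by omega
    have hcmp := pow_sub_pow_window hσ hσρ hρx (d τ - d μ') (d μ' - d l) (Nat.sub_pos_of_lt hdμ')
    rw [← ek] at hcmp
    have ecast : ((d τ - d μ' : ℕ) : ℝ) + ((d μ' - d l : ℕ) : ℝ) = ((d τ - d l : ℕ) : ℝ) := by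
      rw [← Nat.cast_add, ← ek]
    rw [ecast] at hcmp
    -- `hcmp : γ (ρ^{a_l} − σ^{a_l}) ≤ a_l (x₁⁻¹)^{k} (ρ^{γ} − σ^{γ})`; multiply by `q l ≥ 0`
    have := mul_le_mul_of_nonneg_right hcmp (hhead l hl)
    nlinarith [this]
  have hhead_sum : -(((s⁻¹) ^ (d τ - d μ') - (t⁻¹) ^ (d τ - d μ'))
        * ∑ l ∈ univ.filter (fun l => l ≤ h), ((d τ - d l : ℕ) : ℝ) * (x₁⁻¹) ^ (d μ' - d l) * q l)
      ≤ ((d τ - d μ' : ℕ) : ℝ) * ∑ l ∈ univ.filter (fun l => l ≤ h), f l := by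
    rw [Finset.mul_sum, Finset.mul_sum, ← Finset.sum_neg_distrib]
    refine Finset.sum_le_sum fun l hl => ?_
    have hb := hhead_bound l (Finset.mem_filter.1 hl).2
    have e : ((s⁻¹) ^ (d τ - d μ') - (t⁻¹) ^ (d τ - d μ'))
          * (((d τ - d l : ℕ) : ℝ) * (x₁⁻¹) ^ (d μ' - d l) * q l)
        = ((d τ - d l : ℕ) : ℝ) * (x₁⁻¹) ^ (d μ' - d l)
          * ((s⁻¹) ^ (d τ - d μ') - (t⁻¹) ^ (d τ - d μ')) * q l := by ring
    rw [e]
    exact hb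
  have hts : 0 ≤ (s⁻¹) ^ (d τ - d μ') - (t⁻¹) ^ (d τ - d μ') :=
    sub_nonneg.2 (pow_le_pow_left₀ hσ hσρ _)
  have hdom' := mul_le_mul_of_nonneg_left hdom hts
  have hkey : 0 ≤ ((d τ - d μ' : ℕ) : ℝ) * (∑ l ∈ univ.filter (fun l => l ≤ h), f l + f μ') := by
    rw [mul_add, hfμ]
    nlinarith [hhead_sum, hdom']
  have hkey' : 0 ≤ ∑ l ∈ univ.filter (fun l => l ≤ h), f l + f μ' :=
    nonneg_of_mul_nonneg_right hkey hγ
  linarith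

/-! ## §3 From scalars to Loewner monotonicity -/

variable {ι : Type*} [Fintype ι]

/-- Quadratic form of a finite combination of letters: `vᵀ(∑_{l∈T} cₗSₗ)v = ∑_{l∈T} cₗ·vᵀSₗv`. [folklore] -/
theorem quadForm_finsum (T : Finset (Fin K)) (c : Fin K → ℝ) (S : Fin K → Matrix ι ι ℝ) (v : ι → ℝ) :
    v ⬝ᵥ ((∑ l ∈ T, c l • S l) *ᵥ v) = ∑ l ∈ T, c l * (v ⬝ᵥ (S l *ᵥ v)) := by
  rw [Matrix.sum_mulVec, dotProduct_sum]
  refine Finset.sum_congr rfl fun l _ => ?_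
  rw [Matrix.smul_mulVec, dotProduct_smul, smul_eq_mul]

/-- Difference of two normalised quadratic forms, termwise. [folklore] -/
theorem quadForm_diff (d : Fin K → ℕ) (S : Fin K → Matrix ι ι ℝ) (a b ca cb : ℝ) (v : ι → ℝ) :
    v ⬝ᵥ (((ca • ∑ l, (a ^ d l) • S l) - (cb • ∑ l, (b ^ d l) • S l)) *ᵥ v)
      = ∑ l, (a ^ d l * ca - b ^ d l * cb) * (v ⬝ᵥ (S l *ᵥ v)) := by
  rw [Matrix.sub_mulVec, dotProduct_sub, LoewnerSector.quadForm_smul_family,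
    LoewnerSector.quadForm_smul_family, Finset.mul_sum, Finset.mul_sum, ← Finset.sum_sub_distrib]
  refine Finset.sum_congr rfl fun l _ => ?_
  ring

end DominantMiddle

/-! ## §4 The dominant-middle law -/

/-- **DOMINANT-MIDDLE LAW (two sign alternations, K-free).**  Real symmetric letters `Sₗ` at strictly increasing
exponents; blocks HEAD `l ≤ h` (`Sₗ ⪰ 0`), MIDDLE `h < l < τ` (`Sₗ ⪯ 0`), TAIL `l ≥ τ` (`Sₗ ⪰ 0`); a scale `x₁ > 0` and
middle letters `μ, μ'` with the dominance inequalities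
`(d_μ − d_h)·(−S_μ) − ∑_{l ≥ τ} (d_l − d_h)·x₁^{d_l − d_μ}·S_l ⪰ 0` and
`(d_τ − d_μ')·(−S_μ') − ∑_{l ≤ h} (d_τ − d_l)·(x₁⁻¹)^{d_μ' − d_l}·S_l ⪰ 0`.
Then `det (∑ₗ X^{dₗ} Sₗ)` has at most `2·card ι` distinct positive zeros — the Cameron–Psarrakos count `n·α` for
`α = 2` [CameronPsarrakos2019, display (6)], false without dominance (tree `cameronPsarrakos_counterexample`),
restored under it. [folklore] -/
theorem dominantMiddle (ι : Type) [Fintype ι] [DecidableEq ι] (K : ℕ) (d : Fin K → ℕ) (hd : StrictMono d)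
    (S : Fin K → Matrix ι ι ℝ) (hS : ∀ l, (S l).IsSymm) (h μ μ' τ : Fin K)
    (hhμ : h < μ) (hμτ : μ < τ) (hhμ' : h < μ') (hμ'τ : μ' < τ)
    (hhead : ∀ l, l ≤ h → (S l).PosSemidef) (hmid : ∀ l, h < l → l < τ → (-S l).PosSemidef)
    (htail : ∀ l, τ ≤ l → (S l).PosSemidef) (x₁ : ℝ) (hx₁ : 0 < x₁)
    (hdom₁ : ((((d μ - d h : ℕ) : ℝ)) • (-S μ)
      - ∑ l ∈ univ.filter (fun l => τ ≤ l), (((d l - d h : ℕ) : ℝ) * x₁ ^ (d l - d μ)) • S l).PosSemidef)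
    (hdom₂ : ((((d τ - d μ' : ℕ) : ℝ)) • (-S μ')
      - ∑ l ∈ univ.filter (fun l => l ≤ h), (((d τ - d l : ℕ) : ℝ) * (x₁⁻¹) ^ (d μ' - d l)) • S l
        ).PosSemidef) :
    ((Matrix.det (∑ l, ((Polynomial.X : Polynomial ℝ) ^ d l) • (S l).map Polynomial.C)
        ).roots.toFinset.filter (fun t => 0 < t)).card ≤ 2 * Fintype.card ι := by
  -- scalar data extracted from the matrix hypotheses, for a fixed vector `v`
  have hq : ∀ v : ι → ℝ,
      (∀ l, l ≤ h → 0 ≤ v ⬝ᵥ (S l *ᵥ v)) ∧ (∀ l, h < l → l < τ → v ⬝ᵥ (S l *ᵥ v) ≤ 0) ∧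
      (∀ l, τ ≤ l → 0 ≤ v ⬝ᵥ (S l *ᵥ v)) ∧
      (∑ l ∈ univ.filter (fun l => τ ≤ l), ((d l - d h : ℕ) : ℝ) * x₁ ^ (d l - d μ) * (v ⬝ᵥ (S l *ᵥ v))
        ≤ ((d μ - d h : ℕ) : ℝ) * (-(v ⬝ᵥ (S μ *ᵥ v)))) ∧
      (∑ l ∈ univ.filter (fun l => l ≤ h), ((d τ - d l : ℕ) : ℝ) * (x₁⁻¹) ^ (d μ' - d l) * (v ⬝ᵥ (S l *ᵥ v))
        ≤ ((d τ - d μ' : ℕ) : ℝ) * (-(v ⬝ᵥ (S μ' *ᵥ v)))) := by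
    intro v
    refine ⟨fun l hl => ?_, fun l hl hl' => ?_, fun l hl => ?_, ?_, ?_⟩
    · simpa only [star_trivial] using (hhead l hl).dotProduct_mulVec_nonneg v
    · have h0 := (hmid l hl hl').dotProduct_mulVec_nonneg v
      rw [star_trivial, Matrix.neg_mulVec, dotProduct_neg] at h0
      linarith
    · simpa only [star_trivial] using (htail l hl).dotProduct_mulVec_nonneg v
    · have h0 := hdom₁.dotProduct_mulVec_nonneg v
      rw [star_trivial, Matrix.sub_mulVec, dotProduct_sub, Matrix.smul_mulVec, dotProduct_smul, smul_eq_mul,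
        Matrix.neg_mulVec, dotProduct_neg, DominantMiddle.quadForm_finsum] at h0
      linarith
    · have h0 := hdom₂.dotProduct_mulVec_nonneg v
      rw [star_trivial, Matrix.sub_mulVec, dotProduct_sub, Matrix.smul_mulVec, dotProduct_smul, smul_eq_mul,
        Matrix.neg_mulVec, dotProduct_neg, DominantMiddle.quadForm_finsum] at h0
      linarith
  have hsymm : ∀ (a b ca cb : ℝ),
      ((ca • ∑ l, (a ^ d l) • S l) - (cb • ∑ l, (b ^ d l) • S l)).IsHermitian := by
    intro a b ca cb
    have h0 : ((ca • ∑ l, (a ^ d l) • S l) - (cb • ∑ l, (b ^ d l) • S l)).IsSymm := by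
      unfold Matrix.IsSymm
      rw [Matrix.transpose_sub, (LoewnerSector.smul_family_isSymm d S hS ca a).eq,
        (LoewnerSector.smul_family_isSymm d S hS cb b).eq]
    exact Matrix.isHermitian_iff_isSymm.2 h0
  refine twoWindows_posRoots_le ι d S hS x₁ hx₁ (fun u => u ^ d h) (fun u => u ^ d τ)
    (fun u hu _ => pow_pos hu _) (fun u hu => pow_pos (hx₁.trans_le hu) _) ?_ ?_
  · -- left window: `F/x^{d_h}` non-increasing on `(0, x₁]`
    intro s t hs hst htx
    refine Matrix.PosSemidef.of_dotProduct_mulVec_nonneg (hsymm s t _ _) fun v => ?_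
    rw [star_trivial, DominantMiddle.quadForm_diff]
    obtain ⟨h1, h2, h3, h4, _⟩ := hq v
    exact DominantMiddle.left_window_nonneg d hd h μ τ hhμ hμτ (fun l => v ⬝ᵥ (S l *ᵥ v)) h1 h2 h3 x₁
      h4 hs hst htx
  · -- right window: `F/x^{d_τ}` non-decreasing on `[x₁, ∞)`
    intro s t hxs hst
    refine Matrix.PosSemidef.of_dotProduct_mulVec_nonneg (hsymm t s _ _) fun v => ?_
    rw [star_trivial, DominantMiddle.quadForm_diff]
    obtain ⟨h1, h2, h3, _, h5⟩ := hq v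
    exact DominantMiddle.right_window_nonneg d hd h μ' τ hhμ' hμ'τ (fun l => v ⬝ᵥ (S l *ᵥ v)) h1 h2 h3 x₁
      hx₁ h5 hxs hst

end Summit.ValiantsHypothesis.ValiantsHypothesis.Theorems.LacunarySymmetroidMatrixDescartes
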